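import Summits.QuantumAdvantage.QuantumAdvantage.Theorems.ArithStatLadderDigitRungStubLow
import Summits.QuantumAdvantage.QuantumAdvantage.Theorems.ArithStatLadderDigitRungStubHigh
import Summits.QuantumAdvantage.QuantumAdvantage.Theorems.ArithStatLadderDigitRungStubFourier
import Summits.QuantumAdvantage.QuantumAdvantage.Theorems.ArithStatLadderDigitRungStubFundWeyl

/-!
# `DigitRung` (stmt-QuantumAdvantage-15008, ex 2423), line `Sketch` — the composition

The reduction skeleton `Cruxes/DigitRung/Lines/Sketch.lean` made sorry-free in everything except
its one open input. With `t = quadFieldThreeTorsion = #Cl₃`, `𝒟_n = Negative.block n`, `X = 2^n`: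

`DigitRung` follows from
* the vendored named fact `btt_threeTorsion_sum` (Bhargava–Taniguchi–Thorne, in print, unproved in
  the tree) — consumed by the landed `stub_high` (top digits `10j ≥ 7n`, and the block mean);
* the route's support item `EndJuntaRung` (stmt-QuantumAdvantage-2426, in print) — consumed by the
  landed `stub_low` (bounded depths);
* the **`3`-torsion-weighted Weyl-sum input** at the depths `K₀(ε) ≤ k ≤ 7n/10 + 1`, `r` odd:
  `k·‖Σ_{d ∈ 𝒟_n} #Cl₃(−d)·e(d r/2^k)‖ ≤ ε·#𝒟_n` eventually — the registered stub `stub_torsWeyl`,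
  i.e. cancellation in `Σ_F e(r·Disc F/2^k)` over complex cubic fields (Hasse): in print for
  `2^k ≤ X^{5/43}` (Taniguchi–Thorne), NOT IN PRINT in the middle band — taken here as a hypothesis,
  spelled out verbatim;
through the landed `stub_fourier` (square-wave Fourier glue) and `stub_fundWeyl` (unweighted Weyl
sums over fundamental discriminants), `Negative.digitRung_iff_canonical` and
`Negative.concl_iff_total_and_walsh`. This file is the registered stub `stub_composition`
(concluding the canonical form `Concl quadFieldThreeTorsion`; `digitRung_of` below rewrites it to the
route decl); the item itself stays open exactly at `stub_torsWeyl`.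
-/

noncomputable section

namespace Summit.QuantumAdvantage.DigitRung.Sketch

open scoped Classical FourierTransform
open Filter Finset
open Literature.NumberTheory.QuadraticFields
open Summit.QuantumAdvantage.DigitRung.Negative
open Summit.QuantumAdvantage.QuantumAdvantage.Theses.ArithStatLadder (DigitRung EndJuntaRung)

namespace Composition

/-- `W = T − 2F`: the centred Weyl sum in terms of the weighted and the unweighted one. [folklore] -/
theorem weylSum_eq (n k r : ℕ) :
    (∑ d ∈ block n, ((quadFieldThreeTorsion (-(d:ℤ)) : ℂ) - 2) *
        (𝐞 ((d : ℝ) * ((r : ℝ) / 2 ^ k)) : ℂ)) =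
      (∑ d ∈ block n, (quadFieldThreeTorsion (-(d:ℤ)) : ℂ) * (𝐞 ((d : ℝ) * ((r : ℝ) / 2 ^ k)) : ℂ)) -
        2 * ∑ d ∈ block n, (𝐞 ((d : ℝ) * ((r : ℝ) / 2 ^ k)) : ℂ) := by
  rw [Finset.mul_sum, ← Finset.sum_sub_distrib]
  refine Finset.sum_congr rfl fun d _ => ?_
  ring

/-- **The centred Weyl input** at all depths `1 ≤ k ≤ 7n/10 + 1`, assembled from `stub_low`
(bounded depths, from `EndJuntaRung`), `stub_fundWeyl` (proved) and the weighted Weyl-sum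
hypothesis. [folklore] -/
theorem weyl_input (hEJ : EndJuntaRung)
    (hT : ∀ ε : ℝ, 0 < ε → ∃ K₀ : ℕ, ∀ᶠ n : ℕ in atTop, ∀ k r : ℕ, K₀ ≤ k → 10 * k ≤ 7 * n + 10 →
      Odd r → r < 2 ^ k →
      (k : ℝ) * ‖∑ d ∈ block n, (quadFieldThreeTorsion (-(d:ℤ)) : ℂ) *
          (𝐞 ((d : ℝ) * ((r : ℝ) / 2 ^ k)) : ℂ)‖ ≤ ε * ((block n).card : ℝ)) :
    ∀ ε : ℝ, 0 < ε → ∀ᶠ n : ℕ in atTop, ∀ k r : ℕ, 1 ≤ k → 10 * k ≤ 7 * n + 10 → Odd r →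
      r < 2 ^ k →
      (k : ℝ) * ‖∑ d ∈ block n, ((quadFieldThreeTorsion (-(d:ℤ)) : ℂ) - 2) *
          (𝐞 ((d : ℝ) * ((r : ℝ) / 2 ^ k)) : ℂ)‖ ≤ ε * ((block n).card : ℝ) := by
  intro ε hε
  obtain ⟨K₀, hK₀⟩ := hT (ε / 3) (by positivity)
  set K : ℕ := max K₀ 5 with hKdef
  have hK1 : (1 : ℝ) ≤ K := by exact_mod_cast (le_max_right K₀ 5).trans' (by norm_num)
  have hKpos : (0 : ℝ) < K := by linarith
  filter_upwards [stub_low hEJ K (ε / K) (by positivity), stub_fundWeyl (ε / 3) (by positivity),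
    hK₀] with n hL hF hT' k r hk1 hkn hro hr
  set F : ℂ := ∑ d ∈ block n, (𝐞 ((d : ℝ) * ((r : ℝ) / 2 ^ k)) : ℂ) with hFdef
  set T : ℂ := ∑ d ∈ block n, (quadFieldThreeTorsion (-(d:ℤ)) : ℂ) *
    (𝐞 ((d : ℝ) * ((r : ℝ) / 2 ^ k)) : ℂ) with hTdef
  set W : ℂ := ∑ d ∈ block n, ((quadFieldThreeTorsion (-(d:ℤ)) : ℂ) - 2) *
    (𝐞 ((d : ℝ) * ((r : ℝ) / 2 ^ k)) : ℂ) with hWdef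
  by_cases hk : k ≤ K
  · have h := hL k r hk1 hk hro hr
    have hkK : (k : ℝ) ≤ K := by exact_mod_cast hk
    calc (k : ℝ) * ‖W‖ ≤ K * (ε / K * ((block n).card : ℝ)) :=
          mul_le_mul hkK h (norm_nonneg _) hKpos.le
      _ = ε * ((block n).card : ℝ) := by field_simp
  · have hk5 : 5 ≤ k := le_of_lt ((le_max_right K₀ 5).trans_lt (not_le.mp hk))
    have hkK₀ : K₀ ≤ k := le_of_lt ((le_max_left K₀ 5).trans_lt (not_le.mp hk))
    have hF' : (k : ℝ) * ‖F‖ ≤ ε / 3 * ((block n).card : ℝ) := hF k r hk5 hkn hro hr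
    have hT'' : (k : ℝ) * ‖T‖ ≤ ε / 3 * ((block n).card : ℝ) := hT' k r hkK₀ hkn hro hr
    have hWTF : W = T - 2 * F := weylSum_eq n k r
    rw [hWTF]
    calc (k : ℝ) * ‖T - 2 * F‖
        ≤ (k : ℝ) * (‖T‖ + 2 * ‖F‖) := by
          gcongr
          calc ‖T - 2 * F‖ ≤ ‖T‖ + ‖2 * F‖ := norm_sub_le _ _
            _ = ‖T‖ + 2 * ‖F‖ := by rw [norm_mul, Complex.norm_ofNat]
      _ = (k : ℝ) * ‖T‖ + 2 * ((k : ℝ) * ‖F‖) := by ring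
      _ ≤ ε / 3 * ((block n).card : ℝ) + 2 * (ε / 3 * ((block n).card : ℝ)) := by gcongr
      _ = ε * ((block n).card : ℝ) := by ring

/-- The Walsh correlation, cast to `ℂ`, expanded in Weyl sums through square-wave coefficients.
[folklore] -/
theorem walsh_eq_sum_weylSum {j : ℕ} {c : ℕ → ℂ}
    (hc : ∀ d : ℕ, ((walshSign j d : ℝ) : ℂ) =
      ∑ r ∈ Finset.range (2 ^ (j + 1)), c r * (𝐞 ((d : ℝ) * ((r : ℝ) / 2 ^ (j + 1))) : ℂ)) (n : ℕ) :
    ((walsh quadFieldThreeTorsion n j : ℝ) : ℂ) =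
      ∑ r ∈ Finset.range (2 ^ (j + 1)), c r *
        ∑ d ∈ block n, ((quadFieldThreeTorsion (-(d:ℤ)) : ℂ) - 2) *
          (𝐞 ((d : ℝ) * ((r : ℝ) / 2 ^ (j + 1))) : ℂ) := by
  unfold walsh
  push_cast
  simp_rw [hc, Finset.mul_sum]
  rw [Finset.sum_comm]
  refine Finset.sum_congr rfl fun r _ => Finset.sum_congr rfl fun d _ => ?_
  ring

/-- From the Fourier expansion and a uniform bound on the odd-frequency Weyl sums, a bound on the
Walsh correlation. [folklore] -/
theorem abs_walsh_le_of_weyl {j : ℕ} {c : ℕ → ℂ} {M B : ℝ} (hB : 0 ≤ B)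
    (hmass : (∑ r ∈ Finset.range (2 ^ (j + 1)), ‖c r‖) ≤ M)
    (hodd : ∀ r, ¬ Odd r → c r = 0)
    (hc : ∀ d : ℕ, ((walshSign j d : ℝ) : ℂ) =
      ∑ r ∈ Finset.range (2 ^ (j + 1)), c r * (𝐞 ((d : ℝ) * ((r : ℝ) / 2 ^ (j + 1))) : ℂ))
    (n : ℕ) (hW : ∀ r : ℕ, Odd r → r < 2 ^ (j + 1) →
      ‖∑ d ∈ block n, ((quadFieldThreeTorsion (-(d:ℤ)) : ℂ) - 2) *
          (𝐞 ((d : ℝ) * ((r : ℝ) / 2 ^ (j + 1))) : ℂ)‖ ≤ B) :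
    |walsh quadFieldThreeTorsion n j| ≤ M * B := by
  have h1 : |walsh quadFieldThreeTorsion n j| = ‖((walsh quadFieldThreeTorsion n j : ℝ) : ℂ)‖ := by
    rw [Complex.norm_real, Real.norm_eq_abs]
  rw [h1, walsh_eq_sum_weylSum hc n]
  calc ‖∑ r ∈ Finset.range (2 ^ (j + 1)), c r *
        ∑ d ∈ block n, ((quadFieldThreeTorsion (-(d:ℤ)) : ℂ) - 2) *
          (𝐞 ((d : ℝ) * ((r : ℝ) / 2 ^ (j + 1))) : ℂ)‖
      ≤ ∑ r ∈ Finset.range (2 ^ (j + 1)), ‖c r *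
        ∑ d ∈ block n, ((quadFieldThreeTorsion (-(d:ℤ)) : ℂ) - 2) *
          (𝐞 ((d : ℝ) * ((r : ℝ) / 2 ^ (j + 1))) : ℂ)‖ := norm_sum_le _ _
    _ ≤ ∑ r ∈ Finset.range (2 ^ (j + 1)), ‖c r‖ * B := by
        refine Finset.sum_le_sum fun r hr => ?_
        rw [norm_mul]
        by_cases hro : Odd r
        · exact mul_le_mul_of_nonneg_left (hW r hro (Finset.mem_range.mp hr)) (norm_nonneg _)
        · rw [hodd r hro, norm_zero, zero_mul, zero_mul]
    _ = (∑ r ∈ Finset.range (2 ^ (j + 1)), ‖c r‖) * B := by rw [Finset.sum_mul]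
    _ ≤ M * B := mul_le_mul_of_nonneg_right hmass hB

end Composition

open Composition in
/-- **Stub (composition) — `DigitRung` from its three inputs.** If the `3`-torsion-weighted Weyl
sums over the block at the depths `K₀(ε) ≤ k ≤ 7n/10 + 1` cancel (`stub_torsWeyl`, the open middle
band, taken as the hypothesis `hT` verbatim), then the Bhargava–Taniguchi–Thorne named fact
`btt_threeTorsion_sum` (through the landed `stub_high`: top digits and the block mean) and the
route's support item `EndJuntaRung` (through the landed `stub_low`: bounded depths) give
`DigitRung` in its canonical form `Concl quadFieldThreeTorsion` (`= DigitRung` by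
`digitRung_iff_canonical`): by `concl_iff_total_and_walsh` it is the block mean
plus the weight-one Walsh bounds; a Walsh correlation at position `j < 7n/10` is the square-wave
combination (`stub_fourier`, mass `≤ A(j+1)`) of the centred Weyl sums at depth `j + 1`
(`weyl_input`: `stub_low` + `stub_fundWeyl` + `hT`), and at `j ≥ 7n/10` both digit halves are
already small (`stub_high`). [folklore] -/
theorem stub_composition
    (hT : ∀ ε : ℝ, 0 < ε → ∃ K₀ : ℕ, ∀ᶠ n : ℕ in atTop, ∀ k r : ℕ, K₀ ≤ k → 10 * k ≤ 7 * n + 10 →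
      Odd r → r < 2 ^ k →
      (k : ℝ) * ‖∑ d ∈ block n, (quadFieldThreeTorsion (-(d:ℤ)) : ℂ) *
          (𝐞 ((d : ℝ) * ((r : ℝ) / 2 ^ k)) : ℂ)‖ ≤ ε * ((block n).card : ℝ))
    (hbtt : btt_threeTorsion_sum) (hEJ : EndJuntaRung) : Concl quadFieldThreeTorsion := by
  rw [concl_iff_total_and_walsh]
  constructor
  · -- block mean: the top digit `j = n - 1`, `b = true`, selects the whole block
    intro ε hε
    filter_upwards [stub_high hbtt ε hε, eventually_ge_atTop 4] with n hn hn4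
    have h := hn (n - 1) (by omega) (by omega) true
    rwa [dev, half_pred_true (by omega)] at h
  · intro ε hε
    obtain ⟨A, hA⟩ := stub_fourier
    set A' : ℝ := max A 1 with hA'
    have hA'pos : 0 < A' := lt_of_lt_of_le one_pos (le_max_right _ _)
    have hAA' : A ≤ A' := le_max_left _ _
    filter_upwards [weyl_input hEJ hT (ε / A') (div_pos hε hA'pos),
      stub_high hbtt (ε / 2) (half_pos hε), eventually_ge_atTop 4] with n hW hH hn4 j hj
    by_cases hjn : 7 * n ≤ 10 * j
    · -- top digits: both halves are small, hence so is their difference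
      rw [walsh_eq_dev_sub_dev]
      have h0 := hH j hj hjn false
      have h1 := hH j hj hjn true
      calc |dev quadFieldThreeTorsion n j false - dev quadFieldThreeTorsion n j true|
          ≤ |dev quadFieldThreeTorsion n j false| + |dev quadFieldThreeTorsion n j true| :=
            abs_sub _ _
        _ ≤ ε / 2 * ((block n).card : ℝ) + ε / 2 * ((block n).card : ℝ) := add_le_add h0 h1
        _ = ε * ((block n).card : ℝ) := by ring
    · -- the remaining digits: Fourier expansion + Weyl input at depth `k = j + 1`
      push Not at hjn
      obtain ⟨c, hmass, hodd, hc⟩ := hA j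
      have hcard : (0 : ℝ) ≤ ((block n).card : ℝ) := Nat.cast_nonneg _
      have hB : ∀ r : ℕ, Odd r → r < 2 ^ (j + 1) →
          ‖∑ d ∈ block n, ((quadFieldThreeTorsion (-(d:ℤ)) : ℂ) - 2) *
              (𝐞 ((d : ℝ) * ((r : ℝ) / 2 ^ (j + 1))) : ℂ)‖ ≤
            ε / A' * ((block n).card : ℝ) / (j + 1) := by
        intro r hro hr
        have h := hW (j + 1) r (by omega) (by omega) hro hr
        rw [le_div_iff₀ (by positivity)]
        rw [mul_comm] at h
        exact_mod_cast h
      have hmass' : (∑ r ∈ Finset.range (2 ^ (j + 1)), ‖c r‖) ≤ A' * (j + 1) :=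
        hmass.trans (mul_le_mul_of_nonneg_right hAA' (by positivity))
      calc |walsh quadFieldThreeTorsion n j|
          ≤ A' * (j + 1) * (ε / A' * ((block n).card : ℝ) / (j + 1)) :=
            abs_walsh_le_of_weyl (by positivity) hmass' hodd hc n hB
        _ = ε * ((block n).card : ℝ) := by
            field_simp

/-- **`DigitRung` from its three inputs** (the route decl itself): the weighted Weyl-sum input
(`stub_torsWeyl`'s statement), the named fact `btt_threeTorsion_sum` and the support item
`EndJuntaRung`. [folklore] -/
theorem digitRung_of_torsWeyl
    (hT : ∀ ε : ℝ, 0 < ε → ∃ K₀ : ℕ, ∀ᶠ n : ℕ in atTop, ∀ k r : ℕ, K₀ ≤ k → 10 * k ≤ 7 * n + 10 →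
      Odd r → r < 2 ^ k →
      (k : ℝ) * ‖∑ d ∈ block n, (quadFieldThreeTorsion (-(d:ℤ)) : ℂ) *
          (𝐞 ((d : ℝ) * ((r : ℝ) / 2 ^ k)) : ℂ)‖ ≤ ε * ((block n).card : ℝ))
    (hbtt : btt_threeTorsion_sum) (hEJ : EndJuntaRung) : DigitRung :=
  digitRung_iff_canonical.mpr (stub_composition hT hbtt hEJ)

end Summit.QuantumAdvantage.DigitRung.Sketch

end
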